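import Summits.BirchSwinnertonDyer.BirchSwinnertonDyer.Theorems.MordellShaFreeCutBDPTripleUpToCensus
import Summits.BirchSwinnertonDyer.BirchSwinnertonDyer.Theorems.CongruentShaFreeCutTextbookDualityImQuad

set_option linter.dupNamespace false
set_option autoImplicit false

/-! # Route `MordellShaFreeCut` (rung S2b), crux B `AnalyticRankOneOfRankOneFiniteShaThree`
(stmt-BirchSwinnertonDyer-19160) — the kernel census WITH NO TEXTBOOK HYPOTHESIS

Cell `bsd-cn100`, prover seat `bsd-cn100-s2b-c3` (g5). Supports, does not close,
stmt-BirchSwinnertonDyer-19160. After the cell's (F1) campaign the Poitou–Tate reciprocity law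
`∑_v inv_v = 0` on `H²(Γ_K, μ_n)` is a TREE THEOREM for every totally complex number field
(`poitouTate_sum_localTatePairing_eq_zero_of_isTotallyComplex`, `PoitouTateSumTotallyComplex.lean`,
2026-08-26), hence for the imaginary quadratic (Heegner) fields at which the lines of record
`three-adic-bdp-triple` v5c / `heegner-field-bdp-triple` v6b demand it — the registered textbook stub
`stub_textbookDualityImQuad` (filing of record `CongruentShaFreeCutTextbookDualityImQuad.stub_textbookDualityImQuad`).
This file DISCHARGES the hypothesis `hPT` of the S2b census (`MordellShaFreeCutPoitouTateImQuad.lean`,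
`MordellShaFreeCutThreeAdicBDPTripleUpTo.lean`) and records what crux B now rests on in the kernel:

* `threeAdicControlOfRankOne_holds` — **Link A of S2b `ThreeAdicControlOfRankOne` holds OUTRIGHT**
  (the `@[conjecture]` def of `MordellShaFreeCutThreeAdicLinks`, p424081, is now a theorem: anticyclotomic
  control «rank 1 ∧ Ш[3^∞] finite over a Heegner field with `3` split ⟹ `char_Λ 𝔛` has a generator
  non-vanishing at `𝟙`», from Poitou–Tate + Jetchev–Skinner–Wan-style control, all tree theorems);
* `heegnerNonTorsionAtThree_of_bdpTriple` / `…_of_bdpTripleUpTo` — Heegner non-torsion ⟸ Kato + the three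
  BDP statements (exact / ♯), no other input;
* `cruxB_of_bdpTriple`, `cruxB_of_bdpTripleUpTo` — **crux B ⟸ {(LB-exist), (LB-wan), (LB-bdp)} (exact, the
  registered v5c stubs; or their ♯ forms, the hedge p450685) + six refereed facts, NOTHING ELSE**;
* `cruxB_of_linkB` — the v3/v4 record likewise: crux B ⟸ Link B `ThreeAdicCharValueEqHeegnerLogSq` + six
  refereed facts.

So, in the kernel, as of this file: every input of crux B other than the three research statements at the
additive prime `3` is either a refereed named fact (3-parity, modularity, Hoffstein–Luo, Kato, Gross 1984,
Gross–Zagier–Kolyvagin) or PROVED. HONEST FRAMING: CONDITIONAL reductions; nothing here proves crux B,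
crux A, the leaf `rankOne_threeConverse_mordellCurve`, Sylvester's conjecture or any case of BSD; the three
research statements are named (`MordellShaFreeCutThreeAdicBDPTriple[UpTo]`), not asserted.
PARTITION: none — RANK axis.

[cite: MilneADT2006, Ch. I, Thm. 4.10(b)] [cite: CasselsFrohlichANT1967, Ch. VII §10]
[cite: JetchevSkinnerWan2017, Prop. 3.2.1 and §3.3] [cite: CastellaGrossiLeeSkinner2022, §5.2 (proof of Thm. 5.2.1)]
[cite: GrossZagier1986, Thm. I.6.3 with V.§2] -/

noncomputable section

open scoped Classical

namespace Summit.BirchSwinnertonDyer.BirchSwinnertonDyer.Theorems.MordellShaFreeCutCensusPTFree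

open PowerSeries WeierstrassCurve NumberField IsDedekindDomain Field Literature.NumberTheory.EllipticCurves
  Literature.NumberTheory.EllipticCurves.ModularForms Literature.NumberTheory.QuadraticFields
  Literature.NumberTheory.EllipticCurves.Castella2018
open Literature.NumberTheory.GaloisRepresentations Literature.NumberTheory.GaloisCohomology
open Summit.BirchSwinnertonDyer.BirchSwinnertonDyer.Theses.MordellShaFreeCut
open Summit.BirchSwinnertonDyer.BirchSwinnertonDyer.Theorems.CongruentShaFreeCutTextbookDualityImQuad
  renaming stub_textbookDualityImQuad → textbookDualityImQuad
open Summit.BirchSwinnertonDyer.BirchSwinnertonDyer.Theorems.MordellShaFreeCutThreeAdicLinks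
  (ThreeAdicControlOfRankOne ThreeAdicCharValueEqHeegnerLogSq cruxB_of_threeAdicLinks)
open Summit.BirchSwinnertonDyer.BirchSwinnertonDyer.Theorems.MordellShaFreeCutThreeAdicBDPTriple
  (ThreeAdicBDPElementExists ThreeAdicWanDivisibility ThreeAdicBDPValueAtOne
    stub_heegnerNonTorsion_of_linkA_of_bdpTriple)
open Summit.BirchSwinnertonDyer.BirchSwinnertonDyer.Theorems.MordellShaFreeCutThreeAdicBDPTripleUpTo
  (ThreeAdicBDPElementExistsUpTo ThreeAdicWanDivisibilityUpTo ThreeAdicBDPValueAtOneUpTo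
    heegnerNonTorsion_of_linkA_of_bdpTripleUpTo cruxB_of_bdpTripleUpTo_of_poitouTate_imaginaryQuadratic)
open Summit.BirchSwinnertonDyer.BirchSwinnertonDyer.Theorems.MordellShaFreeCutPoitouTateImQuad
  (threeAdicControlOfRankOne_of_poitouTate_imaginaryQuadratic cruxB_of_bdpTriple_of_poitouTate_imaginaryQuadratic)

/-! ## 1. Link A of S2b holds outright -/

/-- **Link A of rung S2b, `ThreeAdicControlOfRankOne`, HOLDS** (the `@[conjecture]` statement of
`MordellShaFreeCutThreeAdicLinks`, now a theorem): for a globally minimal `j = 0` curve `W/ℚ` of rank one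
with `Ш(W/ℚ)[3^∞]` finite, a Heegner field `K` for its conductor in which `3 = v v̄` splits, the
anticyclotomic `ℤ₃`-extension `κ` with topological generator `γ`, the characteristic ideal of Castella's
anticyclotomic Selmer module `𝔛 = X_ac^∅` at the strict place `v̄` has a generator `F ∈ ℤ₃⟦T⟧` with
`F(0) ≠ 0`.  Proof: the imaginary-quadratic glue `threeAdicControlOfRankOne_of_poitouTate_imaginaryQuadratic`
(base finiteness of Castella's Selmer group from Poitou–Tate, then the tower control
`hasCharValuationAt_of_finite_selmerAcBase`) fed with the tree's Poitou–Tate theorem at the imaginary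
quadratic fields (`CongruentShaFreeCutTextbookDualityImQuad.stub_textbookDualityImQuad`, p455245).  UNCONDITIONAL; discharges a Summits-side conjecture-def;
proves no case of BSD. [cite: JetchevSkinnerWan2017, Prop. 3.2.1 and §3.3]
[cite: MilneADT2006, Ch. I, Thm. 4.10(b)] [cite: Greenberg1999, Lemma 3.3 and Prop. 3.8 (control shape)] -/
theorem threeAdicControlOfRankOne_holds : ThreeAdicControlOfRankOne :=
  threeAdicControlOfRankOne_of_poitouTate_imaginaryQuadratic textbookDualityImQuad

/-! ## 2. Heegner non-torsion from Kato and the BDP triple alone -/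

/-- **Heegner non-torsion at `3` ⟸ Kato + (LB-exist) + (LB-wan) + (LB-bdp)**: the registered plumbing
`stub_heegnerNonTorsion_of_linkA_of_bdpTriple` (p439508) with Link A discharged
(`threeAdicControlOfRankOne_holds`): for a globally minimal rank-one `j = 0` curve `W` with `Ш[3^∞]` finite
and a Heegner field `K` (conductor hypothesis, `3` split, `L(W^K, 1) ≠ 0`), every Heegner point of conductor
`N` over `K` has infinite order.  CONDITIONAL on Kato's theorem (refereed) and the three research statements;
credits nothing beyond the reduction. [cite: CastellaGrossiLeeSkinner2022, §5.2 (proof of Thm. 5.2.1)]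
[cite: Kato2004, Cor. 14.3] -/
theorem heegnerNonTorsionAtThree_of_bdpTriple
    (hKato : ∀ (W : WeierstrassCurve ℚ) [W.IsElliptic] (p : ℕ) [Fact p.Prime],
      kato_finite_of_L_one_ne_zero W p)
    (hE : ThreeAdicBDPElementExists) (hWan : ThreeAdicWanDivisibility) (hV : ThreeAdicBDPValueAtOne) :
    ∀ (W : WeierstrassCurve ℚ) [W.IsElliptic] [W.IsGloballyMinimal], W.j = 0 →
      ∀ (K : Type) [Field K] [NumberField K] (N : ℕ) [NeZero N], W.conductorNorm ℤ = N →
        IsImaginaryQuadratic K → SatisfiesHeegnerHypothesis N K → SatisfiesHeegnerHypothesis 3 K →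
          (W.quadraticTwist (NumberField.discr K : ℚ)).entireLFunction 1 ≠ 0 →
            W.mordellWeilRank = 1 → Finite (AddCommGroup.primaryComponent W.sha 3) →
              ∀ (P : (W.baseChange K).toAffine.Point), IsHeegnerPoint N W K P →
                ¬ IsOfFinAddOrder P :=
  stub_heegnerNonTorsion_of_linkA_of_bdpTriple hKato threeAdicControlOfRankOne_holds hE hWan hV

/-- **Heegner non-torsion at `3` ⟸ Kato + the ♯ triple (BDP statements UP TO NONZERO CONSTANTS)**: the
ported plumbing `heegnerNonTorsion_of_linkA_of_bdpTripleUpTo` (p450685) with Link A discharged.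
CONDITIONAL; credits nothing beyond the reduction. [cite: CastellaGrossiLeeSkinner2022, §5.2 (proof of Thm. 5.2.1)]
[cite: Kato2004, Cor. 14.3] -/
theorem heegnerNonTorsionAtThree_of_bdpTripleUpTo
    (hKato : ∀ (W : WeierstrassCurve ℚ) [W.IsElliptic] (p : ℕ) [Fact p.Prime],
      kato_finite_of_L_one_ne_zero W p)
    (hE : ThreeAdicBDPElementExistsUpTo) (hWan : ThreeAdicWanDivisibilityUpTo)
    (hV : ThreeAdicBDPValueAtOneUpTo) :
    ∀ (W : WeierstrassCurve ℚ) [W.IsElliptic] [W.IsGloballyMinimal], W.j = 0 →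
      ∀ (K : Type) [Field K] [NumberField K] (N : ℕ) [NeZero N], W.conductorNorm ℤ = N →
        IsImaginaryQuadratic K → SatisfiesHeegnerHypothesis N K → SatisfiesHeegnerHypothesis 3 K →
          (W.quadraticTwist (NumberField.discr K : ℚ)).entireLFunction 1 ≠ 0 →
            W.mordellWeilRank = 1 → Finite (AddCommGroup.primaryComponent W.sha 3) →
              ∀ (P : (W.baseChange K).toAffine.Point), IsHeegnerPoint N W K P →
                ¬ IsOfFinAddOrder P :=
  heegnerNonTorsion_of_linkA_of_bdpTripleUpTo hKato threeAdicControlOfRankOne_holds hE hWan hV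

/-! ## 3. Crux B from the BDP triple and six refereed facts — nothing else -/

/-- **KERNEL CENSUS OF CRUX B (exact currency, the registered line v5c): `AnalyticRankOneOfRankOneFiniteShaThree`
⟸ (LB-exist) + (LB-wan) + (LB-bdp) + six refereed facts** (`3`-parity, modularity, Hoffstein–Luo, Kato,
existence of Heegner points, Gross–Zagier–Kolyvagin) — the census `cruxB_of_bdpTriple_of_poitouTate_imaginaryQuadratic`
(p448851) with its textbook hypothesis DISCHARGED by the tree's Poitou–Tate theorem.  The ONLY non-refereed
inputs left are the three research statements at the additive prime `3`.  CONDITIONAL; credits nothing beyond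
the reduction. [cite: CastellaGrossiLeeSkinner2022, §5.2 (proof of Thm. 5.2.1)] [cite: GrossZagier1986, Thm. I.6.3 with V.§2]
[cite: Kato2004, Cor. 14.3] [cite: DokchitserDokchitserAnnals2010, Thm. 1.4] -/
theorem cruxB_of_bdpTriple
    (hpar : ∀ (W : WeierstrassCurve ℚ) [W.IsElliptic] (p : ℕ) [Fact p.Prime], p_parity W p)
    (hmod : ModularForms.exists_isNewformOf) (hHL : HoffsteinLuo1997_exists_twist_L_one_ne_zero)
    (hKato : ∀ (W : WeierstrassCurve ℚ) [W.IsElliptic] (p : ℕ) [Fact p.Prime],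
      kato_finite_of_L_one_ne_zero W p)
    (hHP : ∀ (W : WeierstrassCurve ℚ) (K : Type) [Field K] [NumberField K],
      exists_isHeegnerPoint W K)
    (hGZ : ∀ (W : WeierstrassCurve ℚ) (N : ℕ) [NeZero N] (K : Type) [Field K] [NumberField K],
      analyticRankEK_eq_one_iff_heegner_nonTorsion W N K)
    (hE : ThreeAdicBDPElementExists) (hWan : ThreeAdicWanDivisibility) (hV : ThreeAdicBDPValueAtOne) :
    AnalyticRankOneOfRankOneFiniteShaThree :=
  cruxB_of_bdpTriple_of_poitouTate_imaginaryQuadratic hpar hmod hHL hKato hHP hGZ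
    textbookDualityImQuad hE hWan hV

/-- **KERNEL CENSUS OF CRUX B (♯ currency, the hedge p450685): `AnalyticRankOneOfRankOneFiniteShaThree`
⟸ (LB-exist♯) + (LB-wan♯) + (LB-bdp♯) + six refereed facts** — `cruxB_of_bdpTripleUpTo_of_poitouTate_imaginaryQuadratic`
with its textbook hypothesis DISCHARGED.  CONDITIONAL; credits nothing beyond the reduction.
[cite: CastellaGrossiLeeSkinner2022, §5.2 (proof of Thm. 5.2.1)] [cite: GrossZagier1986, Thm. I.6.3 with V.§2] -/
theorem cruxB_of_bdpTripleUpTo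
    (hpar : ∀ (W : WeierstrassCurve ℚ) [W.IsElliptic] (p : ℕ) [Fact p.Prime], p_parity W p)
    (hmod : ModularForms.exists_isNewformOf) (hHL : HoffsteinLuo1997_exists_twist_L_one_ne_zero)
    (hKato : ∀ (W : WeierstrassCurve ℚ) [W.IsElliptic] (p : ℕ) [Fact p.Prime],
      kato_finite_of_L_one_ne_zero W p)
    (hHP : ∀ (W : WeierstrassCurve ℚ) (K : Type) [Field K] [NumberField K],
      exists_isHeegnerPoint W K)
    (hGZ : ∀ (W : WeierstrassCurve ℚ) (N : ℕ) [NeZero N] (K : Type) [Field K] [NumberField K],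
      analyticRankEK_eq_one_iff_heegner_nonTorsion W N K)
    (hE : ThreeAdicBDPElementExistsUpTo) (hWan : ThreeAdicWanDivisibilityUpTo)
    (hV : ThreeAdicBDPValueAtOneUpTo) :
    AnalyticRankOneOfRankOneFiniteShaThree :=
  cruxB_of_bdpTripleUpTo_of_poitouTate_imaginaryQuadratic hpar hmod hHL hKato hHP hGZ
    textbookDualityImQuad hE hWan hV

/-- **The v3/v4 record likewise: crux B ⟸ Link B `ThreeAdicCharValueEqHeegnerLogSq` + six refereed facts**
(`cruxB_of_threeAdicLinks`, p424081, with Link A discharged by `threeAdicControlOfRankOne_holds`; compare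
`MordellShaFreeCutThreeAdicControlOfSelmerFinite.cruxB_of_linkB`, p429896, which still carried Poitou–Tate at
every number field and the local Euler characteristic as hypotheses).  CONDITIONAL; credits nothing beyond the
reduction. [cite: CastellaGrossiLeeSkinner2022, §5.2 (proof of Thm. 5.2.1)] [cite: GrossZagier1986, Thm. I.6.3 with V.§2] -/
theorem cruxB_of_linkB
    (hpar : ∀ (W : WeierstrassCurve ℚ) [W.IsElliptic] (p : ℕ) [Fact p.Prime], p_parity W p)
    (hmod : ModularForms.exists_isNewformOf) (hHL : HoffsteinLuo1997_exists_twist_L_one_ne_zero)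
    (hKato : ∀ (W : WeierstrassCurve ℚ) [W.IsElliptic] (p : ℕ) [Fact p.Prime],
      kato_finite_of_L_one_ne_zero W p)
    (hHP : ∀ (W : WeierstrassCurve ℚ) (K : Type) [Field K] [NumberField K],
      exists_isHeegnerPoint W K)
    (hGZ : ∀ (W : WeierstrassCurve ℚ) (N : ℕ) [NeZero N] (K : Type) [Field K] [NumberField K],
      analyticRankEK_eq_one_iff_heegner_nonTorsion W N K)
    (hB : ThreeAdicCharValueEqHeegnerLogSq) :
    AnalyticRankOneOfRankOneFiniteShaThree :=
  cruxB_of_threeAdicLinks hpar hmod hHL hKato hHP hGZ threeAdicControlOfRankOne_holds hB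

end Summit.BirchSwinnertonDyer.BirchSwinnertonDyer.Theorems.MordellShaFreeCutCensusPTFree

end
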